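import Literature.NumberTheory.EllipticCurves.Cha2005.ShaIndexBoundIrreducible
import Literature.NumberTheory.EllipticCurves.Tamagawa
import HarnessLib

/-!
# Miller 2011, Thm. 5.4: Jetchev's Tamagawa sharpening of the Heegner-index bound, in the case of Cha's hypotheses (irreducible, not necessarily surjective `ρ̄_{E,p}`)

HONEST FRAMING (cell `b2b-bsdres`, run/shared/lean/b2b/bsd-rank1-residual/, verbatim): the goal of
the cell is to DELETE the COMBINATION-SHAPED residual classes for ALL analytic-rank `≤ 1` elliptic
curves over `ℚ` — "full BSD formula for every rank `≤ 1` curve in class C" assembled STRICTLY from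
published theorems — so that the rank-`≤ 1` remainder becomes exactly the CONSTRUCTION-SHAPED
classes, which are TYPED (missing-input Props), NOT attempted; this is not "finishing BSD".
This file vendors ONE published theorem as a named fact (`def … : Prop`, nothing asserted;
D-0014) plus its certificate case. It is NOT a class theorem for X9 and changes no label: it is
the printed lever for the X9 pairs at which `p` divides exactly one Tamagawa number, where Cha's
bound alone (`Cha2005.thm52_padicValNat_shaOrder_le`) can never certify `Ш(E/ℚ)[p] = 0`
(Gross–Zagier + BSD force `p ∣ I_K` there; GJPST 2009 Rem. 3.13).

## Sources and what was read (X9 prover GEN 7, unit `b2b-bsdres-x9-g7`, 2026-08-19)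

* R. L. Miller, *Proving the Birch and Swinnerton-Dyer conjecture for specific elliptic curves of
  analytic rank zero and one*, LMS J. Comput. Math. **14** (2011) 327–350 = arXiv:1010.2431
  [read: `paper:arxiv-1010.2431` p0011.txt L42–L50]: "Jetchev [jetchev_m_max] has improved the
  upper bound with the following: **Theorem 5.4 (Jetchev).** If the hypotheses of any of Theorems
  (big-result) [5.1, Kolyvagin: `ρ̄_{E,p}` surjective], (cha) [5.2: `r_an(E/ℚ) ≤ 1`, `p ∤ 2·Δ(K)`,
  `p² ∤ N`, `ρ̄_{E,p}` irreducible] or (stein-et-al) [5.3] apply to `p`, then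
  `ord_p(#Ш(ℚ, E)) ≤ 2 · (ord_p(I_K) − max_{q ∣ N} ord_p(c_q))`. If `p` divides at most one
  Tamagawa number then this upper bound is equal to `ord_p(#Ш(ℚ,E)_an)`." Setting of Miller §4–§5
  [p0009 L3, p0010 L20]: `E/ℚ` of conductor `N`, `K = ℚ(√D)` satisfying the Heegner hypothesis
  for `E`, `y_K ∈ E(K)` the Heegner point of a modular parametrisation of minimal degree,
  `I_K = [E(K)_{/tors} : ℤ y_K]`, `c_q` the Tamagawa numbers of `E/ℚ`. Miller's proof of his main
  theorem USES the Cha case of Thm. 5.4 [p0015 L1]: "Now suppose that `E[p]` is not surjective. …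
  each chosen Heegner discriminant and index is not divisible by 5 except for `E` = 3468h. … by
  Cha's theorem … For `E` = 3468h note that one of the Tamagawa numbers is 5, so by Theorem
  (jetchev), `BSD(E, 5)` is true for this curve." (3468h1 at `p = 5` is an X9 pair: image `5S4`,
  good ordinary, rank 0.)
* D. Jetchev, *Global divisibility of Heegner points and Tamagawa numbers*, Compos. Math. **144**
  (2008) 811–826 = arXiv:math/0703431 [read: `paper:arxiv-math_0703431` p0003 L32–L80, p0007
  L96–L104, p0015 L11–L31]: Thm. 1.4 (`m_∞ ≥ m_max`) and Cor. 1.5 (`#Ш(E/K)[p^∞] ≤ p^{2 m_0 − 2 m_max}`)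
  are printed under "Hypothesis (\*): `p ∤ N` and … `ρ_{E,p}` is surjective", with the footnote
  "Recently, Byungchul Cha (see [cha:vanishing]) has been able to weaken Hypothesis (\*)" on
  Kolyvagin's formula (1) `#Ш(E/K)[p^∞] = p^{2(m_0 − m_∞)}`, and Remark 6.2: "Hypothesis (\*) can be
  weakened as the proof of [McCallum] does not need the surjectivity of the Galois representation,
  but simply the weaker assumption that `End_{𝔽_p}(E[p])` is spanned … by the elements
  `σ ∈ Gal(ℚ(E[p])/ℚ)`. This fact is equivalent to the absolute irreducibility of … `ρ_{E,p}`."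
  The tree's `Jetchev2008.cor15_padicValNat_card_primaryComponent_sha_le` vendors Cor. 1.5 AS
  PRINTED (surjective); this file does not touch it.
* B. Cha, J. Number Theory **111** (2005) 154–178 — primary source of Thm. 5.2. Not held when
  this file was written (acq-08222; flag `Cha05-primary-unread` carried from
  `Cha2005/ShaIndexBoundIrreducible.lean`); HELD since the 2026-08-21 ingest
  (`paper:cha2005-vanishing-some-cohomology-groups-bounds-shafarevich-tate`) and READ 2026-08-21
  (RESIDUAL-MAP literature seat rmap-3 g6; full transcription in the module docstring of
  `Cha2005/ShaIndexBoundIrreducible.lean`): the printed result is **Thm. 21 (p. 173)** — `y_K` of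
  infinite order, `ℓ` odd with `ℓ ∤ D`, "`E` has a good or multiplicative reduction at `ℓ`"
  (= Miller's `p² ∤ N`, so a MULTIPLICATIVE `p ∥ N` is inside the primary), `ρ̄_{E,ℓ}` irreducible,
  `E` non-CM, `K = ℚ(√D)` with fundamental `D ≠ −3, −4` and every prime of `N` split ⇒
  `ord_ℓ |Ш(E/K)| ≤ 2m`, `m = ord_ℓ I_K`; proved from the Main Theorem (Thm. 2) under Assumption 1
  (p. 155) by patching Proposition 2 of Kolyvagin's structure paper [7]. So of the two deviations
  of Thm. 5.4's Cha case from Jetchev's Hypothesis (∗) recorded in the FLAG below, the CHA INPUT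
  at `p² ∤ N` rests on print; what is not printed line by line is only JETCHEV's Tamagawa term at
  `p ∣ N` / for irreducible non-surjective `ρ̄`. (Cha's `D ≠ −3, −4` is waived by Miller, p. 9
  L18, and is not a binder below — see the faithfulness note in the Cha file; no consumer uses
  `K ∈ {ℚ(i), ℚ(√−3)}`.) The flag's retirement is the referee's ruling.
* presearch (D-0021): `lit search --hybrid "Jetchev Tamagawa numbers Heegner index bound … irreducible
  non-surjective"` → textbooks only, none states the bound; `lit search "Jetchev Tamagawa Heegner
  divisibility"` → Kim arXiv:2203.12161 (p. 18: Jetchev used under `ρ̄` SURJECTIVE, p. 5 (a)),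
  Jetchev–Skinner–Wan 2017 §7.4 (surjective), arXiv:2312.09301 (Kolyvagin systems, big image);
  `lit vsearch "… irreducible but not surjective"` → nothing relevant; galaxy saturated (rc: queued
  too long) at 20:50Z. CONCLUSION: the only printed statement of the Tamagawa-sharpened bound
  WITHOUT surjectivity is Miller 2011 Thm. 5.4; its printed proof is the citation of Jetchev 2008,
  whose printed hypothesis is (\*). Hence the flag below.

## FLAG `Miller11-Thm54-Cha-case` (for the referee; recorded, not hidden)

The statement vendored here is a numbered theorem of a refereed paper (LMS JCM 14), used
load-bearingly in that paper's proof of its main theorem (3468h at `p = 5`), and is therefore a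
PUBLISHED statement in the cell's sense (cf. R9.1: a refereed statement is cited with its printed
hypotheses; inputs of its proof are the author's). Its printed justification is a citation of
Jetchev 2008, where Thm. 1.4 / Cor. 1.5 carry Hypothesis (\*) (`ρ̄` surjective); Jetchev's Rem. 6.2
and footnote 1 (Cha) indicate why the argument extends to absolutely irreducible `ρ̄` with Cha's
side conditions, but no line-by-line proof of the extension is printed in either paper. Any pair
closed through this fact is to be booked with the flag, at the referee's discretion (literal tier
or PUB), never silently.

## Faithfulness notes

* Printed: `ord_p #Ш(ℚ,E) ≤ 2(ord_p I_K − max_{q∣N} ord_p c_q)`. Vendored in the MONOTONE form of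
  the tree's Jetchev file: for EVERY prime `q ∣ N`,
  `ord_p #Ш(E/ℚ) + 2·ord_p c_q ≤ 2·ord_p [E(K) : ℤ P]` — verbatim for the `q` attaining the
  maximum, weaker for the others; and with the FULL index `[E(K) : ℤ P]` of the tree
  (`AddSubgroup.index (zmultiples P)`), a multiple of Miller's `I_K` (index modulo torsion) for the
  minimal-degree parametrisation and a further multiple `|n|·I_K` for the Heegner point of any other
  parametrisation datum admitted by `IsHeegnerPoint N W K P` — so the vendored inequality is
  IMPLIED by the printed one (weaker, never stronger), exactly as in
  `Cha2005.thm52_padicValNat_shaOrder_le` and `Jetchev2008.cor15_…`.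
* Hypotheses = those of Miller Thm. 5.2 as vendored in `Cha2005/ShaIndexBoundIrreducible.lean`, word
  for word (non-CM ADDED from GJPST §3.1, `p ≠ 2`, `p ∤ d_K`, `p² ∤ N`, `Irr W p`,
  `W.analyticRank ≤ 1`, `K` imaginary quadratic with the Heegner hypothesis for the level `N`,
  `P = y_K` a Heegner point of infinite order), plus `q` prime with `q ∣ N` and the Tamagawa number
  `c_q = [E(ℚ_q) : E⁰(ℚ_q)]` = `(W.baseChange ℚ_[q]).localTamagawaNumber ℤ_[q]` (file `Tamagawa`,
  computed on the `ℤ_q`-minimal model) as in the Jetchev file. `#Ш(ℚ,E)` = `W.shaOrder` (finite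
  under `r_an ≤ 1` by Gross–Zagier–Kolyvagin; in the junk case `Nat.card = 0`,
  `padicValNat p 0 = 0`). The index is finite and non-zero under the hypotheses (Kolyvagin:
  `rank E(K) = 1` when `y_K` has infinite order), so no junk value of the index arises within the
  hypotheses; `c_q ≠ 0` (`localTamagawaNumber_padic_ne_zero`).
* `p ∤ N` is NOT among Cha's hypotheses (`p² ∤ N` is); for the cell's use (class X9: `p` a GOOD
  prime) `p ∤ N` holds anyway. Size XL; no `_holds`.

## Contents

* `thm54_cha_padicValNat_shaOrder_add_tamagawa_le` — the named fact.
* `padicValNat_shaOrder_eq_zero_of_index_le_tamagawa` — the certificate case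
  `ord_p [E(K) : ℤ y_K] ≤ ord_p c_q` for one `q ∣ N`: then `ord_p #Ш(E/ℚ) = 0`.
* `padicValNat_shaOrder_le_of_index_sub_tamagawa` — the general numeric form
  `ord_p #Ш(E/ℚ) ≤ 2(v − w)` from `ord_p [E(K):ℤP] ≤ v`, `w ≤ ord_p c_q`.
-/

noncomputable section

open scoped Classical

open WeierstrassCurve Literature.NumberTheory.EllipticCurves
  Literature.NumberTheory.EllipticCurves.Rank1Residual

namespace Literature.NumberTheory.EllipticCurves.Miller2011

/-- **Miller 2011, Thm. 5.4 (Jetchev's bound) under the hypotheses of Thm. 5.2 (Cha)** — R. L.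
Miller, LMS J. Comput. Math. 14 (2011), arXiv:1010.2431 p. 11: "If the hypotheses of any of
Theorems 5.1, 5.2 or 5.3 apply to `p`, then `ord_p(#Ш(ℚ, E)) ≤ 2·(ord_p(I_K) − max_{q∣N} ord_p(c_q))`",
here with Thm. 5.2's hypotheses ("`r_an(E/ℚ) ≤ 1` and `p` is a prime such that `p ∤ 2·Δ(K)`,
`p² ∤ N` and `ρ̄_{E,p}` is irreducible"; setting of §4: `K` Heegner for `N`, `y_K` the Heegner point,
`I_K = [E(K)_{/tors} : ℤ y_K]`, `c_q` the Tamagawa numbers). Vendored, for a non-CM `E/ℚ` (minimal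
model `W`), in the monotone form: for every prime `q ∣ N`,
`ord_p #Ш(E/ℚ) + 2·ord_p c_q ≤ 2·ord_p [E(K) : ℤ P]` (full index; weaker than print, see the module
docstring). FLAG `Miller11-Thm54-Cha-case`: the printed proof is the citation "Jetchev [Compos.
Math. 144 (2008)]", whose Thm. 1.4 / Cor. 1.5 are printed under Hypothesis (\*) (`ρ̄` surjective);
Jetchev's Rem. 6.2 (absolute irreducibility suffices for the Čebotarev lemma) and footnote 1 (Cha
weakened (\*)) are the indicated ingredients of the extension; Miller uses this case for 3468h at
`p = 5`. Size XL; no `_holds`.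
[cite: Miller2011LMS, Thm. 5.4 (arXiv:1010.2431 p. 11 L42–L50); §8 proof for 3468h (p. 15 L1)]
[cite: Jetchev2008, Hypothesis (*), Thm. 1.4, Cor. 1.5 (p. 3); Rem. 6.2 (p. 15)]
[cite: Cha2005, Thm. 21 (JNT 111 (2005) p. 173); Main Thm. 2 and Assumption 1 (p. 155)] -/
def thm54_cha_padicValNat_shaOrder_add_tamagawa_le : Prop :=
  ∀ (W : WeierstrassCurve ℚ) [W.IsElliptic] [W.IsGloballyMinimal] (N : ℕ) [NeZero N]
    (K : Type) [Field K] [NumberField K] (_hK : IsImaginaryQuadratic K)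
    (_hH : SatisfiesHeegnerHypothesis N K) (P : (W.baseChange K).toAffine.Point)
    (_hP : IsHeegnerPoint N W K P) (_hnt : ¬ IsOfFinAddOrder P) (p : ℕ) [Fact p.Prime]
    (q : ℕ) [Fact q.Prime], q ∣ N →
    ¬ W.HasCM → p ≠ 2 → ¬ (p : ℤ) ∣ NumberField.discr K → ¬ p ^ 2 ∣ N → Irr W p →
    W.analyticRank ≤ 1 →
    padicValNat p W.shaOrder + 2 * padicValNat p ((W.baseChange ℚ_[q]).localTamagawaNumber ℤ_[q]) ≤
      2 * padicValNat p (AddSubgroup.zmultiples P).index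

/-- **The certificate case `ord_p [E(K) : ℤ y_K] ≤ ord_p c_q`** of Miller's Thm. 5.4 under Cha's
hypotheses: for a non-CM `E/ℚ` of analytic rank `≤ 1`, a Heegner field `K` and Heegner point `y_K`
of infinite order, an odd prime `p` with `p ∤ d_K`, `p² ∤ N`, `ρ̄_{E,p}` irreducible, and ONE prime
`q ∣ N` whose Tamagawa number absorbs the whole `p`-part of the index, `ord_p #Ш(E/ℚ) = 0`.
(Typical certificate: `ord_p [E(K):ℤ y_K] = 1 = ord_p c_q`, all other `c_{q'}` prime to `p`.)
[cite: Miller2011LMS, Thm. 5.4 (arXiv:1010.2431 p. 11)] -/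
theorem padicValNat_shaOrder_eq_zero_of_index_le_tamagawa
    (h : thm54_cha_padicValNat_shaOrder_add_tamagawa_le)
    (W : WeierstrassCurve ℚ) [W.IsElliptic] [W.IsGloballyMinimal] {N : ℕ} [NeZero N]
    {K : Type} [Field K] [NumberField K] (hK : IsImaginaryQuadratic K)
    (hH : SatisfiesHeegnerHypothesis N K) {P : (W.baseChange K).toAffine.Point}
    (hP : IsHeegnerPoint N W K P) (hnt : ¬ IsOfFinAddOrder P) (p : ℕ) [Fact p.Prime]
    (q : ℕ) [Fact q.Prime] (hqN : q ∣ N)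
    (hcm : ¬ W.HasCM) (hp2 : p ≠ 2) (hpD : ¬ (p : ℤ) ∣ NumberField.discr K) (hpN : ¬ p ^ 2 ∣ N)
    (hirr : Irr W p) (hr : W.analyticRank ≤ 1)
    (hI : padicValNat p (AddSubgroup.zmultiples P).index ≤
      padicValNat p ((W.baseChange ℚ_[q]).localTamagawaNumber ℤ_[q])) :
    padicValNat p W.shaOrder = 0 := by
  have hle := h W N K hK hH P hP hnt p q hqN hcm hp2 hpD hpN hirr hr
  omega

/-- **Numeric form** of Miller's Thm. 5.4 under Cha's hypotheses: from an upper bound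
`ord_p [E(K) : ℤ y_K] ≤ v` (the computed Heegner index) and a lower bound `w ≤ ord_p c_q` at one
prime `q ∣ N`, `ord_p #Ш(E/ℚ) ≤ 2(v − w)` (in `ℕ`, truncated at `0`). [cite: Miller2011LMS, Thm. 5.4 (arXiv:1010.2431 p. 11)] -/
theorem padicValNat_shaOrder_le_of_index_sub_tamagawa
    (h : thm54_cha_padicValNat_shaOrder_add_tamagawa_le)
    (W : WeierstrassCurve ℚ) [W.IsElliptic] [W.IsGloballyMinimal] {N : ℕ} [NeZero N]
    {K : Type} [Field K] [NumberField K] (hK : IsImaginaryQuadratic K)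
    (hH : SatisfiesHeegnerHypothesis N K) {P : (W.baseChange K).toAffine.Point}
    (hP : IsHeegnerPoint N W K P) (hnt : ¬ IsOfFinAddOrder P) (p : ℕ) [Fact p.Prime]
    (q : ℕ) [Fact q.Prime] (hqN : q ∣ N)
    (hcm : ¬ W.HasCM) (hp2 : p ≠ 2) (hpD : ¬ (p : ℤ) ∣ NumberField.discr K) (hpN : ¬ p ^ 2 ∣ N)
    (hirr : Irr W p) (hr : W.analyticRank ≤ 1) {v w : ℕ}
    (hv : padicValNat p (AddSubgroup.zmultiples P).index ≤ v)
    (hw : w ≤ padicValNat p ((W.baseChange ℚ_[q]).localTamagawaNumber ℤ_[q])) :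
    padicValNat p W.shaOrder ≤ 2 * (v - w) := by
  have hle := h W N K hK hH P hP hnt p q hqN hcm hp2 hpD hpN hirr hr
  omega

end Literature.NumberTheory.EllipticCurves.Miller2011

end
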